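import Literature.MathematicalPhysics.QuantumFieldTheory.Balaban1983to89.B3Op116KernelCurrencyTorus
import Literature.MathematicalPhysics.QuantumFieldTheory.Balaban1983to89.B3Op116DKernelRegularCellBox
import Literature.MathematicalPhysics.QuantumFieldTheory.Balaban1983to89.B3Op116HolderKernelRegularBox

/-!
# Bałaban, *(Higgs)₂,₃ quantum fields in a finite volume III* [B3] — THE CONSTANTS OF THE (1.16) KERNEL ON A BOX (ROUTE γ′) ARE UNIFORM IN THE
LATTICE SPACING AND THE SCALE: `valCB ≤ valCBU`, `derCB ≤ derCBU`, `derCBθ ≤ derCBθU`, `holCBθ ≤ holCBθU` with the U-constants explicit functions of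
`(d, L, N, n_F, C, C_H, δ₁, a, α, θ; σ = |e|s, τ ≥ L^k|e|δ_A; M)` and of NOTHING ELSE — file «KernelCurrencyBox» (the currency step of the value /
derivative / Hölder members of (2.5) for (1.16) on `□` without the support clause)

statement-level skeleton of published theorems with citation tags; proofs where landed; nothing here is a claim about the Yang–Mills mass gap

T. Bałaban, Commun. Math. Phys. **88** (1983) 411–445 [cite: Balaban1983Higgs3], (1.16) p. 414, Prop. 1 pp. 420–421, (2.5) p. 424, (2.10)–(2.11)
p. 426, p. 433; part I [cite: Balaban1982Higgs1], (3.14)–(3.16) pp. 614–615.  PDF held: `paper:balaban1983-higgs-2-3-quantum-fields-finite-volume`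
(journal page = PDF page + 410; pp. 420–421 = `p0010.txt`–`p0011.txt`).

CITATION HEADER (lean-in-tree rule).  Cell `lit-balaban` (HOME `run/shared/lean/pub/lit-balaban/`), Phase-2 proof seat **p35** gen 29 (unit
`lit-balaban-p35`, literature-prover-lit-balaban-p35-g29-0); free-target protocol G.5-34(d) (TAKING HOME/STATUS.md 2026-08-25T05:18Z, own lane:
the displayed constants of route γ′ are p35's `valCB`, `derCB`, `derCBθ`, `holCBθ`); the row owner's (r15) record «no γ′ currency lemma (unlike δ's
`collarK_currency`)» (GAPS G-B3-16.A1 OWNER NOTE 5 (c), `GAMMA-PREREAD-g20.md` §3(d)) is what this file supplies.  SKELETON rows **B3.Eq1.16** /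
**B3.Eq2.5** / **B3.Txt@433** (fold owner r15) — located members, no head claim.  Model: p40's `B3Op116CollarCurrency`.  USED BY NAME, never
restated: C1 `B3Op116KernelCurrencyTorus.{gE₀, convK₀, convK_eq, stepCU, stepC_currency, kapU, mesh_mul_kap4_le, inv_mul_cK1_le, inv_mul_cK2_eq,
mesh_mul_inv_mesh_zero_mul, mesh_zero_le_mesh}`, p35's `B3Op116MajorantStepBox.{faceK, pendK, stepBoxC, stepBoxVC}`, `B3Op116CollarRowReduce.kapF`,
`B3Op116DKernelRegularBox.{seqB, rateB, cvB, cdB, cSB, seqB_zero, seqB_succ, seqB_pos, valCB, derCB}`, `B3Op116DKernelRegularCellBox.{sheetEndC,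
derCBθ}`, `B3Op116HolderKernelRegularBox.{sheetHolC, holCBθ}`, `B3Op116DKernelRegularTorus.{cK1, kap4}`, p40's `B3Op116CollarCurrency.{faceC₀,
blkK₀, faceC₀_nonneg}`.

## What is printed (verbatim)

[B3] Prop. 1, pp. 420–421 [PDF 10–11]: *"The constant O(1) depends on α₀, n̄ … and is independent of ε, k, the domains Ω, Ω₁, Ω₂, the vector field
B̃ (if they satisfy the conditions mentioned previously)."*  p. 414 [PDF 4]: *"… uniformly bounded by O(1)(e(L^kε)^{1−α})^{n+n′}"*.  p. 433 [PDF 23]: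
the one-piece expansion in `B̃′` on the cube `□` (route γ′ of the cell: no support clause on `Ã`, the faces of `□` booked as sheets).

## What this file proves, and how

The γ′ theorems display their constants as the explicit recursion `seqB = (δ_J, cv_J, cd_J, cS_J)` of `B3Op116DKernelRegularBox` evaluated at the
lattice.  DEGREES: with the unit seeds `cv, cd ∝ ε^d` and the sheet one degree lower, `cS ∝ ε^{d−1}` (`cS_{J+1} = κ_F·cv_J`, `κ_F = kapF ∝ ε^{−1}`);
`faceK ∝ (ε^{d−1})^{−1}`, `pendK = convK·faceK ∝ ε^{−d}(ε^{d−1})^{−1}` — so every summand of `stepBoxC` / `stepBoxVC` is again of degree `d` and the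
powers of `ε` cancel identically.  §1 the `ε`-free parts `faceK₀`, `pendK₀` (`faceK = faceK₀·ε·(ε^d)^{−1}`, `pendK = pendK₀·ε·(ε^d)^{−2}`) and
**`mesh_zero_mul_kapF_le`**: `ε·κ_F ≤ kapFU(d, σ, τ) = d((τ + σ) + (3σ + 2σ²))` (`|e|δ_A ≤ L^k|e|δ_A ≤ τ`, `ε ≤ L^kε ≤ 1`); §2 **`stepBoxC_currency`**,
**`stepBoxVC_currency`**: with any normalisation `ν ≥ 0` of the value/derivative slots and `νε` of the sheet slot, one box step is bounded by the
`ε`-FREE, `k`-FREE `stepBoxCU` / `stepBoxVCU` (C1's `stepC_currency` + the two sheet pairings + the face charges); §3 the dominating recursion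
**`seqBU`** and **`seqB_currency`** (`ν·cvB ≤ U.2.1`, `ν·cdB ≤ U.2.2.1`, `νε·cSB ≤ U.2.2.2`, all `J`); §4 the end sheets: `(ε^d)^{−1}·sheetEndC ≤
sheetEndCU`, `(ε^d)^{−1}·κ_F·sheetHolC ≤ kapFU·sheetHolCU`; §5 **`valCB_currency`**, **`derCB_currency`**, **`derCBθ_currency`**,
**`holCBθ_currency`**: for `L > 1`, `1 ≤ k`, `L^kε ≤ 1`, `a > 0`, `δ₁ > 0`, `C, C_H, s, δ_A ≥ 0`, `L^k|e|δ_A ≤ τ`, `θ > 0`, `α < 1`, above the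
thresholds, at the seeds `(ε^dC, cK1)` of the cell-box plugs (`kernel116_value_cellBox_le` & co.): the displayed constants are `≤` the U-constants
`valCBU / derCBU / derCBθU / holCBθU(d, L, N, n_F, C, C_H, δ₁, a, α, θ, σ, τ; M)` — NO `ε`, NO `k`: Prop. 1's «independent of ε, k» for the γ′
members (given print's smallness parameters `|e|s`, `L^k|e|δ_A`, and `n_F = #faces(□)`, the size of `□` in face slices, p. 433).

## Honest scope

As C1: upper bounds in print's parameters, not the literal `O(1)(e(L^kε)p(L^kε))^{n+n′}`; `n_F` stays a parameter (print: `□` a cube of size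
`≍ r(L^kε)`, p. 433); the rate `δ₁/(4L)^M` is produced after `δ₁`.  The mixed member `mixCB` (and the torus `mixC`) is the sequel `B3Op116MixedCurrency`.
Definitions are `ε`-free real constants; no `def … : Prop`, no new named fact, no `sorry`; axioms standard.  Value = bookkeeping of located members of
a by-reference step of B3 — NOT summit progress and nothing about the Yang–Mills mass gap.
-/

noncomputable section

namespace Literature.MathematicalPhysics.QuantumFieldTheory.Balaban1983to89.B3Op116KernelCurrencyBox

open HiggsLattice (ChargeData)
open B1Eq230FluctCov (Ix)
open B3Op116MajorantStep (convK stepC)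
open B3Op116MajorantStepBox (faceK pendK stepBoxC stepBoxVC)
open B3Op116CollarRowReduce (kapF kapF_nonneg)
open B3Op116DKernelRegularTorus (cK1 kap4 kap4_nonneg cK1_ge)
open B3Op116DKernelRegularBox (seqB rateB cvB cdB cSB seqB_zero seqB_succ seqB_pos valCB derCB)
open B3Op116DKernelRegularCellBox (sheetEndC derCBθ)
open B3Op116HolderKernelRegularBox (sheetHolC holCBθ)
open B3Op116CollarCurrency (faceC₀ blkK₀ faceC₀_nonneg)
open B3Op116KernelCurrencyTorus (gE₀ gE₀_nonneg convK₀ convK₀_nonneg convK_eq stepCU stepCU_nonneg stepC_currency kapU kapU_nonneg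
  mesh_mul_kap4_le inv_mul_cK1_le inv_mul_cK2_eq mesh_mul_inv_mesh_zero_mul mesh_zero_le_mesh)

variable {P : HiggsLattice.Params} {N : ℕ}

/-! ## §1 The `ε`-free parts of the face constants, and the face-leg weight -/

section EpsFree

/-- `(ε^{d−1})^{−1} = ε·(ε^d)^{−1}` (`d ≥ 1`): the surface normalisation of a face sum is one power of `ε` above the volume one.
[cite: Balaban1983Higgs3, (2.6) p.424, p.433] -/
theorem inv_pow_pred_eq : (P.mesh 0 ^ (P.d - 1))⁻¹ = P.mesh 0 * (P.mesh 0 ^ P.d)⁻¹ := by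
  have hε : P.mesh 0 ≠ 0 := (P.mesh_pos 0).ne'
  have hd : P.d = (P.d - 1) + 1 := (Nat.sub_add_cancel P.hd).symm
  conv_rhs => rw [hd, pow_succ]
  field_simp

/-- `faceK₀(d, L, δ, a₁, a₂) = (8d/δ)^{d−1}(L^{a₁−1}/(L^{a₁−1}−1) + L^{a₂−1}/(L^{a₂−1}−1))`, the `ε`-free part of the face constant `faceK`.
[cite: Balaban1983Higgs3, (2.6) p.424, (2.10) p.426] -/
def faceK₀ (d : ℕ) (L : ℝ) (δ a₁ a₂ : ℝ) : ℝ := faceC₀ d δ * (gE₀ L (a₁ - 1) + gE₀ L (a₂ - 1))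

/-- `faceK₀ ≥ 0` for `L ≥ 1`, `δ > 0`, `a₁, a₂ ≥ 1`. [cite: Balaban1983Higgs3, (2.10) p.426] -/
theorem faceK₀_nonneg {d : ℕ} {L : ℝ} (hL : 1 ≤ L) {δ a₁ a₂ : ℝ} (hδ : 0 < δ) (ha₁ : 1 ≤ a₁) (ha₂ : 1 ≤ a₂) : 0 ≤ faceK₀ d L δ a₁ a₂ :=
  mul_nonneg (faceC₀_nonneg d hδ) (add_nonneg (gE₀_nonneg hL (by linarith)) (gE₀_nonneg hL (by linarith)))

/-- `faceK = faceK₀·ε·(ε^d)^{−1}`. [cite: Balaban1983Higgs3, (2.10) p.426] -/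
theorem faceK_eq (δ a₁ a₂ : ℝ) : faceK P δ a₁ a₂ = faceK₀ P.d (P.L : ℝ) δ a₁ a₂ * (P.mesh 0 * (P.mesh 0 ^ P.d)⁻¹) := by
  rw [← inv_pow_pred_eq]
  unfold faceK faceK₀ faceC₀ gE₀
  ring

/-- `pendK₀(d, L, N, δ, p, s) = convK₀(δ, p, 1)·faceK₀(δ/2, p+1, s)`, the `ε`-free part of the pending-sheet constant `pendK`.
[cite: Balaban1983Higgs3, (2.6) p.424, (2.10) p.426] -/
def pendK₀ (d : ℕ) (L : ℝ) (N : ℕ) (δ p s : ℝ) : ℝ := convK₀ d L N δ p 1 * faceK₀ d L (δ / 2) (p + 1) s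

/-- `pendK₀ ≥ 0` for `L ≥ 1`, `δ > 0`, `p ≥ 0`, `s ≥ 1`. [cite: Balaban1983Higgs3, (2.10) p.426] -/
theorem pendK₀_nonneg {d : ℕ} {L : ℝ} (hL : 1 ≤ L) (N : ℕ) {δ p s : ℝ} (hδ : 0 < δ) (hp : 0 ≤ p) (hs : 1 ≤ s) : 0 ≤ pendK₀ d L N δ p s :=
  mul_nonneg (convK₀_nonneg hL N hδ hp zero_le_one) (faceK₀_nonneg hL (half_pos hδ) (by linarith) hs)

/-- `pendK = pendK₀·ε·(ε^d)^{−2}`. [cite: Balaban1983Higgs3, (2.10) p.426] -/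
theorem pendK_eq (δ p s : ℝ) :
    pendK P N δ p s = pendK₀ P.d (P.L : ℝ) N δ p s * (P.mesh 0 * ((P.mesh 0 ^ P.d)⁻¹ * (P.mesh 0 ^ P.d)⁻¹)) := by
  unfold pendK pendK₀
  rw [convK_eq, faceK_eq]
  ring

/-- print's face-leg combination `kapFU(d, σ, τ) = d((τ + σ) + (3σ + 2σ²))`, the uniform bound of `ε·κ_F`. [cite: Balaban1982Higgs1, (3.16) p.615] [cite: Balaban1983Higgs3, p.433] -/
def kapFU (d : ℕ) (σ τ : ℝ) : ℝ := (d : ℝ) * ((τ + σ) + (3 * σ + 2 * σ ^ 2))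

/-- `kapFU ≥ 0` (`σ, τ ≥ 0`). [cite: Balaban1983Higgs3, p.433] -/
theorem kapFU_nonneg (d : ℕ) {σ τ : ℝ} (hσ : 0 ≤ σ) (hτ : 0 ≤ τ) : 0 ≤ kapFU d σ τ := by
  unfold kapFU; positivity

/-- **the face-leg weight times `ε` is uniform**: `ε·κ_F ≤ kapFU(d, |e|s, τ)` for `L^kε ≤ 1` and `L^k|e|δ_A ≤ τ`
(`ε·κ_F = d((|e|δ_A + |e|s) + (3|e|s + 2ε(|e|s)²))`, `|e|δ_A ≤ L^k|e|δ_A`, `ε ≤ L^kε ≤ 1`). [cite: Balaban1982Higgs1, (3.16) p.615] [cite: Balaban1983Higgs3, p.433] -/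
theorem mesh_zero_mul_kapF_le {C : ChargeData N} {k : ℕ} (hmesh : P.mesh k ≤ 1) {s δA τ : ℝ} (hs : 0 ≤ s) (hδA : 0 ≤ δA)
    (hτ : (P.L : ℝ) ^ k * (|C.e| * δA) ≤ τ) : P.mesh 0 * kapF P C s δA ≤ kapFU P.d (|C.e| * s) τ := by
  have hε0 : 0 < P.mesh 0 := P.mesh_pos 0
  have hε1 : P.mesh 0 ≤ 1 := (mesh_zero_le_mesh (P := P) k).trans hmesh
  have hσ : 0 ≤ |C.e| * s := mul_nonneg (abs_nonneg _) hs
  have heA : 0 ≤ |C.e| * δA := mul_nonneg (abs_nonneg _) hδA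
  have hLk : (1 : ℝ) ≤ (P.L : ℝ) ^ k := one_le_pow₀ (by exact_mod_cast P.hL)
  have h1 : |C.e| * δA ≤ τ := le_trans (by nlinarith) hτ
  have hid : P.mesh 0 * kapF P C s δA = (P.d : ℝ) * ((|C.e| * δA + |C.e| * s) + (3 * (|C.e| * s) + 2 * (P.mesh 0 * (|C.e| * s) ^ 2))) := by
    unfold kapF; field_simp
  rw [hid]
  unfold kapFU
  refine mul_le_mul_of_nonneg_left ?_ (Nat.cast_nonneg _)
  have h2 : P.mesh 0 * (|C.e| * s) ^ 2 ≤ (|C.e| * s) ^ 2 := by nlinarith [sq_nonneg (|C.e| * s)]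
  linarith

end EpsFree

/-! ## §2 One box step in uniform currency -/

section Step

/-- **the uniform twin of `stepBoxC`**: C1's `stepCU` plus the two pending-sheet pairings with `c_K ↦ Ĉ`, `c₁ ↦ Ĉ₁`, sheet `c_S ↦ S = νε·c_S`,
`pendK ↦ pendK₀`. [cite: Balaban1983Higgs3, (1.16) p.414, Prop. 1 pp.420–421, (2.10) p.426, p.433] -/
def stepBoxCU (d : ℕ) (L : ℝ) (N : ℕ) (nF : ℕ) (δ aK av Ĉ v w S Ĉ₁ κ₁ τ κ₃ K₄ : ℝ) : ℝ :=
  stepCU d L N δ aK av Ĉ v w κ₁ τ κ₃ K₄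
    + (d : ℝ) * ((nF : ℝ) * (κ₁ * ((Real.exp 1 * Ĉ * Ĉ₁ * S + Ĉ * Ĉ₁ * S) * pendK₀ d L N δ aK (av - 1))))

/-- **the uniform twin of `stepBoxVC`**: `stepBoxCU` plus the resolved face charges with `κ_F ↦ K_F = ε·κ_F`, `faceK ↦ faceK₀`.
[cite: Balaban1983Higgs3, (1.16) p.414, Prop. 1 pp.420–421, (2.10) p.426, p.433] -/
def stepBoxVCU (d : ℕ) (L : ℝ) (N : ℕ) (nF : ℕ) (δ aK av Ĉ v w S Ĉ₁ κ₁ τ κ₃ K₄ KF : ℝ) : ℝ :=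
  stepBoxCU d L N nF δ aK av Ĉ v w S Ĉ₁ κ₁ τ κ₃ K₄ + (nF : ℝ) * (KF * (Ĉ * v * faceK₀ d L δ aK av))

/-- `stepBoxCU ≥ 0` (`L > 1`, `δ > 0`, `a_K > 0`, `a_v ≥ 2`, parameters `≥ 0`). [cite: Balaban1983Higgs3, (2.10) p.426] -/
theorem stepBoxCU_nonneg {d : ℕ} {L : ℝ} (hL : 1 < L) (N nF : ℕ) {δ aK av Ĉ v w S Ĉ₁ κ₁ τ κ₃ K₄ : ℝ} (hδ : 0 < δ) (haK : 0 < aK)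
    (hav : 2 ≤ av) (hĈ : 0 ≤ Ĉ) (hv : 0 ≤ v) (hw : 0 ≤ w) (hS : 0 ≤ S) (hĈ₁ : 0 ≤ Ĉ₁) (hκ₁ : 0 ≤ κ₁) (hτ : 0 ≤ τ) (hκ₃ : 0 ≤ κ₃)
    (hK₄ : 0 ≤ K₄) : 0 ≤ stepBoxCU d L N nF δ aK av Ĉ v w S Ĉ₁ κ₁ τ κ₃ K₄ := by
  have h1 := stepCU_nonneg (d := d) hL N hδ haK (by linarith : 1 < av) hĈ hv hw hκ₁ hτ hκ₃ hK₄
  have h2 : 0 ≤ pendK₀ d L N δ aK (av - 1) := pendK₀_nonneg hL.le N hδ haK.le (by linarith)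
  have he : 0 ≤ Real.exp 1 := Real.exp_nonneg _
  unfold stepBoxCU
  positivity

/-- `stepBoxVCU ≥ 0` (`a_K ≥ 1` in addition). [cite: Balaban1983Higgs3, (2.10) p.426] -/
theorem stepBoxVCU_nonneg {d : ℕ} {L : ℝ} (hL : 1 < L) (N nF : ℕ) {δ aK av Ĉ v w S Ĉ₁ κ₁ τ κ₃ K₄ KF : ℝ} (hδ : 0 < δ) (haK : 1 ≤ aK)
    (hav : 2 ≤ av) (hĈ : 0 ≤ Ĉ) (hv : 0 ≤ v) (hw : 0 ≤ w) (hS : 0 ≤ S) (hĈ₁ : 0 ≤ Ĉ₁) (hκ₁ : 0 ≤ κ₁) (hτ : 0 ≤ τ) (hκ₃ : 0 ≤ κ₃)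
    (hK₄ : 0 ≤ K₄) (hKF : 0 ≤ KF) : 0 ≤ stepBoxVCU d L N nF δ aK av Ĉ v w S Ĉ₁ κ₁ τ κ₃ K₄ KF := by
  have h1 := stepBoxCU_nonneg (d := d) hL N nF hδ (by linarith : 0 < aK) hav hĈ hv hw hS hĈ₁ hκ₁ hτ hκ₃ hK₄
  have h2 : 0 ≤ faceK₀ d L δ aK av := faceK₀_nonneg hL.le hδ haK (by linarith)
  unfold stepBoxVCU
  positivity

/-- monotonicity of a product of three nonnegative factors against a fixed nonnegative multiplier (folklore analysis). [cite: Balaban1983Higgs3, (2.10) p.426] -/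
private theorem prod3_le {a b c a' b' c' m : ℝ} (ha : 0 ≤ a) (hb : 0 ≤ b) (hc : 0 ≤ c) (hm : 0 ≤ m)
    (ha' : a ≤ a') (hb' : b ≤ b') (hc' : c ≤ c') : a * (b * c) * m ≤ a' * (b' * c') * m := by
  have hbc : b * c ≤ b' * c' := mul_le_mul hb' hc' hc (hb.trans hb')
  exact mul_le_mul_of_nonneg_right (mul_le_mul ha' hbc (mul_nonneg hb hc) (ha.trans ha')) hm

variable {k nF : ℕ} {δ aK av ν cK cv cd cS c₁ Ĉ v w S Ĉ₁ κ₁ κ₂ κ₃ κ₄ τ K₄ κF KF : ℝ}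

/-- **ONE BOX STEP, DERIVATIVE COLUMN, IN UNIFORM CURRENCY.**  Under the hypotheses of C1's `stepC_currency` and, for the sheet slot,
`νε·c_S ≤ S`, `(ε^d)^{−1}c₁ ≤ Ĉ₁` (`a_v ≥ 2`): `ν·stepBoxC(k, n_F; δ, a_K, a_v, c_K, c_v, c_d, c_S, c₁, κ₁…κ₄) ≤ stepBoxCU(d, L, N, n_F; δ, a_K, a_v, Ĉ, v, w, S, Ĉ₁, κ₁, τ, κ₃, K₄)`
— the pending pairings carry `c_K·c₁·c_S·pendK ∝ ε^d·ε^d·ε^{d−1}·ε^{1−2d} = ε^d/ν… = (Ĉ)(Ĉ₁)(S)·pendK₀` after normalisation.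
[cite: Balaban1983Higgs3, (1.16) p.414, Prop. 1 pp.420–421, (2.10) p.426, p.433] -/
theorem stepBoxC_currency (hL : 1 < P.L) (hmesh : P.mesh k ≤ 1) (hδ : 0 < δ) (haK : 0 < aK) (hav : 2 ≤ av)
    (hν : 0 ≤ ν) (hcK : 0 ≤ cK) (hĈ : (P.mesh 0 ^ P.d)⁻¹ * cK ≤ Ĉ) (hcv : 0 ≤ cv) (hv : ν * cv ≤ v) (hcd : 0 ≤ cd) (hw : ν * cd ≤ w)
    (hcS : 0 ≤ cS) (hS : ν * P.mesh 0 * cS ≤ S) (hc₁ : 0 ≤ c₁) (hĈ₁ : (P.mesh 0 ^ P.d)⁻¹ * c₁ ≤ Ĉ₁)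
    (hκ₁ : 0 ≤ κ₁) (hκ₂ : 0 ≤ κ₂) (hτ : P.mesh k * κ₂ ≤ τ) (hκ₃ : 0 ≤ κ₃) (hκ₄ : 0 ≤ κ₄) (hK₄ : P.mesh k * κ₄ ≤ K₄) :
    ν * stepBoxC P N k nF δ aK av cK cv cd cS c₁ κ₁ κ₂ κ₃ κ₄ ≤ stepBoxCU P.d (P.L : ℝ) N nF δ aK av Ĉ v w S Ĉ₁ κ₁ τ κ₃ K₄ := by
  have hL1 : (1 : ℝ) < (P.L : ℝ) := by exact_mod_cast hL
  have hE : 0 ≤ (P.mesh 0 ^ P.d)⁻¹ := inv_nonneg.mpr (pow_nonneg (P.mesh_pos 0).le _)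
  have hε : 0 ≤ P.mesh 0 := (P.mesh_pos 0).le
  have hstep := stepC_currency (N := N) hL hmesh hδ haK (by linarith : 1 < av) hν hcK hĈ hcv hv hcd hw hκ₁ hκ₂ hτ hκ₃ hκ₄ hK₄
  have hP : 0 ≤ pendK₀ P.d (P.L : ℝ) N δ aK (av - 1) := pendK₀_nonneg hL1.le N hδ haK.le (by linarith)
  have hX0 : 0 ≤ (P.mesh 0 ^ P.d)⁻¹ * cK := mul_nonneg hE hcK
  have hX1 : 0 ≤ (P.mesh 0 ^ P.d)⁻¹ * c₁ := mul_nonneg hE hc₁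
  have hXS : 0 ≤ ν * P.mesh 0 * cS := mul_nonneg (mul_nonneg hν hε) hcS
  have hid : ν * stepBoxC P N k nF δ aK av cK cv cd cS c₁ κ₁ κ₂ κ₃ κ₄ =
      ν * stepC P N k δ aK av cK cv cd κ₁ κ₂ κ₃ κ₄
        + ((P.mesh 0 ^ P.d)⁻¹ * cK) * (((P.mesh 0 ^ P.d)⁻¹ * c₁) * (ν * P.mesh 0 * cS)) *
            ((P.d : ℝ) * (nF : ℝ) * κ₁ * (Real.exp 1 + 1) * pendK₀ P.d (P.L : ℝ) N δ aK (av - 1)) := by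
    unfold stepBoxC
    rw [pendK_eq]
    ring
  have hU : stepBoxCU P.d (P.L : ℝ) N nF δ aK av Ĉ v w S Ĉ₁ κ₁ τ κ₃ K₄ =
      stepCU P.d (P.L : ℝ) N δ aK av Ĉ v w κ₁ τ κ₃ K₄
        + Ĉ * (Ĉ₁ * S) * ((P.d : ℝ) * (nF : ℝ) * κ₁ * (Real.exp 1 + 1) * pendK₀ P.d (P.L : ℝ) N δ aK (av - 1)) := by
    unfold stepBoxCU
    ring
  rw [hid, hU]
  exact add_le_add hstep (prod3_le hX0 hX1 hXS (by positivity) hĈ hĈ₁ hS)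

/-- **ONE BOX STEP, VALUE COLUMN, IN UNIFORM CURRENCY** (`a_K ≥ 1` in addition, and `ε·κ_F ≤ K_F`):
`ν·stepBoxVC(…, κ_F) ≤ stepBoxVCU(…, K_F)` — the face charges carry `κ_F·c_K·c_v·faceK ∝ ε^{−1}·ε^d·ε^d·ε^{1−d}`.
[cite: Balaban1983Higgs3, (1.16) p.414, Prop. 1 pp.420–421, (2.10) p.426, p.433] -/
theorem stepBoxVC_currency (hL : 1 < P.L) (hmesh : P.mesh k ≤ 1) (hδ : 0 < δ) (haK : 1 ≤ aK) (hav : 2 ≤ av)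
    (hν : 0 ≤ ν) (hcK : 0 ≤ cK) (hĈ : (P.mesh 0 ^ P.d)⁻¹ * cK ≤ Ĉ) (hcv : 0 ≤ cv) (hv : ν * cv ≤ v) (hcd : 0 ≤ cd) (hw : ν * cd ≤ w)
    (hcS : 0 ≤ cS) (hS : ν * P.mesh 0 * cS ≤ S) (hc₁ : 0 ≤ c₁) (hĈ₁ : (P.mesh 0 ^ P.d)⁻¹ * c₁ ≤ Ĉ₁)
    (hκ₁ : 0 ≤ κ₁) (hκ₂ : 0 ≤ κ₂) (hτ : P.mesh k * κ₂ ≤ τ) (hκ₃ : 0 ≤ κ₃) (hκ₄ : 0 ≤ κ₄) (hK₄ : P.mesh k * κ₄ ≤ K₄)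
    (hκF : 0 ≤ κF) (hKF : P.mesh 0 * κF ≤ KF) :
    ν * stepBoxVC P N k nF δ aK av cK cv cd cS c₁ κ₁ κ₂ κ₃ κ₄ κF ≤ stepBoxVCU P.d (P.L : ℝ) N nF δ aK av Ĉ v w S Ĉ₁ κ₁ τ κ₃ K₄ KF := by
  have hL1 : (1 : ℝ) < (P.L : ℝ) := by exact_mod_cast hL
  have hE : 0 ≤ (P.mesh 0 ^ P.d)⁻¹ := inv_nonneg.mpr (pow_nonneg (P.mesh_pos 0).le _)
  have hε : 0 ≤ P.mesh 0 := (P.mesh_pos 0).le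
  have hstep := stepBoxC_currency (N := N) (nF := nF) hL hmesh hδ (by linarith : 0 < aK) hav hν hcK hĈ hcv hv hcd hw hcS hS hc₁ hĈ₁ hκ₁ hκ₂ hτ
    hκ₃ hκ₄ hK₄
  have hF : 0 ≤ faceK₀ P.d (P.L : ℝ) δ aK av := faceK₀_nonneg hL1.le hδ haK (by linarith)
  have hX0 : 0 ≤ (P.mesh 0 ^ P.d)⁻¹ * cK := mul_nonneg hE hcK
  have hXF : 0 ≤ P.mesh 0 * κF := mul_nonneg hε hκF
  have hY0 : 0 ≤ ν * cv := mul_nonneg hν hcv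
  have hid : ν * stepBoxVC P N k nF δ aK av cK cv cd cS c₁ κ₁ κ₂ κ₃ κ₄ κF =
      ν * stepBoxC P N k nF δ aK av cK cv cd cS c₁ κ₁ κ₂ κ₃ κ₄
        + (P.mesh 0 * κF) * (((P.mesh 0 ^ P.d)⁻¹ * cK) * (ν * cv)) * ((nF : ℝ) * faceK₀ P.d (P.L : ℝ) δ aK av) := by
    unfold stepBoxVC
    rw [faceK_eq]
    ring
  have hU : stepBoxVCU P.d (P.L : ℝ) N nF δ aK av Ĉ v w S Ĉ₁ κ₁ τ κ₃ K₄ KF =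
      stepBoxCU P.d (P.L : ℝ) N nF δ aK av Ĉ v w S Ĉ₁ κ₁ τ κ₃ K₄ + KF * (Ĉ * v) * ((nF : ℝ) * faceK₀ P.d (P.L : ℝ) δ aK av) := by
    unfold stepBoxVCU
    ring
  rw [hid, hU]
  exact add_le_add hstep (prod3_le hXF hX0 hY0 (by positivity) hKF hĈ hv)

end Step

/-! ## §3 The dominating recursion of the box state's constants -/

section Recursion

/-- **the uniform twin of the recursion `seqB`**: the same rate component; `stepBoxVCU(2, 2+J, Ĉ₂, …, K_F)`, `stepBoxCU(1, 2+J, Ĉ₁, …)` and the new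
sheet `K_F·v_J`. [cite: Balaban1983Higgs3, (1.16) p.414, Prop. 1 pp.420–421, p.433] -/
def seqBU (d : ℕ) (L : ℝ) (N nF : ℕ) (Ĉ2 Ĉ1 κ₁ τ κ₃ K₄ KF δ₀ v₀ w₀ : ℝ) : ℕ → ℝ × ℝ × ℝ × ℝ
  | 0 => (δ₀, v₀, w₀, 0)
  | J + 1 =>
    ((seqBU d L N nF Ĉ2 Ĉ1 κ₁ τ κ₃ K₄ KF δ₀ v₀ w₀ J).1 / 2 / L / 2,
      stepBoxVCU d L N nF (seqBU d L N nF Ĉ2 Ĉ1 κ₁ τ κ₃ K₄ KF δ₀ v₀ w₀ J).1 2 (2 + (J : ℝ)) Ĉ2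
        (seqBU d L N nF Ĉ2 Ĉ1 κ₁ τ κ₃ K₄ KF δ₀ v₀ w₀ J).2.1 (seqBU d L N nF Ĉ2 Ĉ1 κ₁ τ κ₃ K₄ KF δ₀ v₀ w₀ J).2.2.1
        (seqBU d L N nF Ĉ2 Ĉ1 κ₁ τ κ₃ K₄ KF δ₀ v₀ w₀ J).2.2.2 Ĉ1 κ₁ τ κ₃ K₄ KF,
      stepBoxCU d L N nF (seqBU d L N nF Ĉ2 Ĉ1 κ₁ τ κ₃ K₄ KF δ₀ v₀ w₀ J).1 1 (2 + (J : ℝ)) Ĉ1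
        (seqBU d L N nF Ĉ2 Ĉ1 κ₁ τ κ₃ K₄ KF δ₀ v₀ w₀ J).2.1 (seqBU d L N nF Ĉ2 Ĉ1 κ₁ τ κ₃ K₄ KF δ₀ v₀ w₀ J).2.2.1
        (seqBU d L N nF Ĉ2 Ĉ1 κ₁ τ κ₃ K₄ KF δ₀ v₀ w₀ J).2.2.2 Ĉ1 κ₁ τ κ₃ K₄,
      KF * (seqBU d L N nF Ĉ2 Ĉ1 κ₁ τ κ₃ K₄ KF δ₀ v₀ w₀ J).2.1)

variable {C : ChargeData N} {k nF : ℕ} {a cK2 cK1 s δA δ₀ cv₀ cd₀ : ℝ}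

/-- the rate components of `seqB` and `seqBU` agree. [cite: Balaban1983Higgs3, (2.10) p.426] -/
theorem seqBU_rate (Ĉ2 Ĉ1 κ₁ τ κ₃ K₄ KF v₀ w₀ : ℝ) (J : ℕ) :
    (seqBU P.d (P.L : ℝ) N nF Ĉ2 Ĉ1 κ₁ τ κ₃ K₄ KF δ₀ v₀ w₀ J).1 = rateB P N C k nF a cK2 cK1 s δA δ₀ cv₀ cd₀ J := by
  induction J with
  | zero => exact (seqB_zero (P := P) (N := N) (C := C) (k := k) (nF := nF) (a := a) (cK2 := cK2) (cK1 := cK1) (s := s) (δA := δA)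
      (δ₀ := δ₀) (cv₀ := cv₀) (cd₀ := cd₀)).1.symm
  | succ J ih =>
    rw [(seqB_succ (P := P) (N := N) (C := C) (k := k) (nF := nF) (a := a) (cK2 := cK2) (cK1 := cK1) (s := s) (δA := δA) (δ₀ := δ₀)
      (cv₀ := cv₀) (cd₀ := cd₀) J).1, ← ih]
    rfl

/-- positivity along `seqBU` (`L > 1`, `δ₀ > 0`, seeds and parameters `≥ 0`). [cite: Balaban1983Higgs3, (2.10) p.426] -/
theorem seqBU_nonneg {d : ℕ} {L : ℝ} (hL : 1 < L) {Ĉ2 Ĉ1 κ₁ τ κ₃ K₄ KF δ₀ v₀ w₀ : ℝ} (hδ₀ : 0 < δ₀) (hĈ2 : 0 ≤ Ĉ2) (hĈ1 : 0 ≤ Ĉ1)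
    (hκ₁ : 0 ≤ κ₁) (hτ : 0 ≤ τ) (hκ₃ : 0 ≤ κ₃) (hK₄ : 0 ≤ K₄) (hKF : 0 ≤ KF) (hv₀ : 0 ≤ v₀) (hw₀ : 0 ≤ w₀) (J : ℕ) :
    0 < (seqBU d L N nF Ĉ2 Ĉ1 κ₁ τ κ₃ K₄ KF δ₀ v₀ w₀ J).1 ∧ 0 ≤ (seqBU d L N nF Ĉ2 Ĉ1 κ₁ τ κ₃ K₄ KF δ₀ v₀ w₀ J).2.1 ∧
      0 ≤ (seqBU d L N nF Ĉ2 Ĉ1 κ₁ τ κ₃ K₄ KF δ₀ v₀ w₀ J).2.2.1 ∧ 0 ≤ (seqBU d L N nF Ĉ2 Ĉ1 κ₁ τ κ₃ K₄ KF δ₀ v₀ w₀ J).2.2.2 := by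
  have hL0 : 0 < L := by linarith
  induction J with
  | zero => exact ⟨hδ₀, hv₀, hw₀, le_rfl⟩
  | succ J ih =>
    obtain ⟨h1, h2, h3, h4⟩ := ih
    have hJ : (2 : ℝ) ≤ 2 + (J : ℝ) := by have := (Nat.cast_nonneg J : (0 : ℝ) ≤ J); linarith
    refine ⟨?_, ?_, ?_, ?_⟩
    · show 0 < (seqBU d L N nF Ĉ2 Ĉ1 κ₁ τ κ₃ K₄ KF δ₀ v₀ w₀ J).1 / 2 / L / 2; positivity
    · exact stepBoxVCU_nonneg hL N nF h1 (by norm_num) hJ hĈ2 h2 h3 h4 hĈ1 hκ₁ hτ hκ₃ hK₄ hKF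
    · exact stepBoxCU_nonneg hL N nF h1 (by norm_num) hJ hĈ1 h2 h3 h4 hĈ1 hκ₁ hτ hκ₃ hK₄
    · exact mul_nonneg hKF h2

/-- **THE BOX RECURSION IN UNIFORM CURRENCY.**  On a lattice with `L > 1`, `1 ≤ k`, `L^kε ≤ 1`, for `a > 0`, `s, δ_A ≥ 0`, seeds `c_{K2}, c_{K1} ≥ 0`
with `(ε^d)^{−1}c_{K2} ≤ Ĉ₂`, `(ε^d)^{−1}c_{K1} ≤ Ĉ₁`, `δ₀ > 0`, `c_{v,0}, c_{d,0} ≥ 0`, any normalisation `ν ≥ 0` with `νc_{v,0} ≤ v₀`, `νc_{d,0} ≤ w₀`,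
and `τ ≥ L^k|e|δ_A`: for every `J`, `ν·cvB(J) ≤ U.2.1`, `ν·cdB(J) ≤ U.2.2.1`, `νε·cSB(J) ≤ U.2.2.2` with
`U = seqBU(d, L, N, n_F, Ĉ₂, Ĉ₁, |e|s, τ, (|e|s)², K₄(d,a,|e|s), kapFU(d,|e|s,τ), δ₀, v₀, w₀) J`. [cite: Balaban1983Higgs3, (1.16) p.414, Prop. 1 pp.420–421, (2.10) p.426, p.433] -/
theorem seqB_currency (hL : 1 < P.L) (hk : 1 ≤ k) (hmesh : P.mesh k ≤ 1) (ha : 0 < a) (hs : 0 ≤ s) (hδA : 0 ≤ δA)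
    (hcK2 : 0 ≤ cK2) {Ĉ2 : ℝ} (hĈ2 : (P.mesh 0 ^ P.d)⁻¹ * cK2 ≤ Ĉ2) (hcK1 : 0 ≤ cK1) {Ĉ1 : ℝ} (hĈ1 : (P.mesh 0 ^ P.d)⁻¹ * cK1 ≤ Ĉ1)
    (hδ₀ : 0 < δ₀) (hcv₀ : 0 ≤ cv₀) (hcd₀ : 0 ≤ cd₀) {ν v₀ w₀ τ : ℝ} (hν : 0 ≤ ν) (hv₀ : ν * cv₀ ≤ v₀) (hw₀ : ν * cd₀ ≤ w₀)
    (hτ : (P.L : ℝ) ^ k * (|C.e| * δA) ≤ τ) (J : ℕ) :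
    ν * cvB P N C k nF a cK2 cK1 s δA δ₀ cv₀ cd₀ J ≤
        (seqBU P.d (P.L : ℝ) N nF Ĉ2 Ĉ1 (|C.e| * s) τ ((|C.e| * s) ^ 2) (kapU P.d a (|C.e| * s)) (kapFU P.d (|C.e| * s) τ) δ₀ v₀ w₀ J).2.1 ∧
      ν * cdB P N C k nF a cK2 cK1 s δA δ₀ cv₀ cd₀ J ≤
        (seqBU P.d (P.L : ℝ) N nF Ĉ2 Ĉ1 (|C.e| * s) τ ((|C.e| * s) ^ 2) (kapU P.d a (|C.e| * s)) (kapFU P.d (|C.e| * s) τ) δ₀ v₀ w₀ J).2.2.1 ∧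
      ν * P.mesh 0 * cSB P N C k nF a cK2 cK1 s δA δ₀ cv₀ cd₀ J ≤
        (seqBU P.d (P.L : ℝ) N nF Ĉ2 Ĉ1 (|C.e| * s) τ ((|C.e| * s) ^ 2) (kapU P.d a (|C.e| * s)) (kapFU P.d (|C.e| * s) τ) δ₀ v₀ w₀ J).2.2.2 := by
  have hσ : 0 ≤ |C.e| * s := mul_nonneg (abs_nonneg _) hs
  have hκ₂ : 0 ≤ (P.mesh 0)⁻¹ * (|C.e| * δA) := mul_nonneg (inv_nonneg.mpr (P.mesh_pos 0).le) (mul_nonneg (abs_nonneg _) hδA)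
  have hτ' : P.mesh k * ((P.mesh 0)⁻¹ * (|C.e| * δA)) ≤ τ := by rw [mesh_mul_inv_mesh_zero_mul]; exact hτ
  have hκ₄ : 0 ≤ kap4 P C k a s := kap4_nonneg hs
  have hK₄ : P.mesh k * kap4 P C k a s ≤ kapU P.d a (|C.e| * s) := mesh_mul_kap4_le hL hk hmesh ha hs
  have hκF : 0 ≤ kapF P C s δA := kapF_nonneg hs hδA
  have hKF : P.mesh 0 * kapF P C s δA ≤ kapFU P.d (|C.e| * s) τ := mesh_zero_mul_kapF_le hmesh hs hδA hτ
  have hε : 0 ≤ P.mesh 0 := (P.mesh_pos 0).le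
  induction J with
  | zero =>
    obtain ⟨-, e2, e3, e4⟩ := seqB_zero (P := P) (N := N) (C := C) (k := k) (nF := nF) (a := a) (cK2 := cK2) (cK1 := cK1) (s := s)
      (δA := δA) (δ₀ := δ₀) (cv₀ := cv₀) (cd₀ := cd₀)
    rw [e2, e3, e4, mul_zero]
    exact ⟨hv₀, hw₀, le_rfl⟩
  | succ J ih =>
    obtain ⟨ihv, ihd, ihS⟩ := ih
    obtain ⟨hr0, -, hcvJ, hcdJ, hcSJ⟩ := seqB_pos (P := P) (N := N) (C := C) (k := k) (nF := nF) (a := a) (cK2 := cK2) (cK1 := cK1)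
      (s := s) (δA := δA) (δ₀ := δ₀) (cv₀ := cv₀) (cd₀ := cd₀) (δ₁ := δ₀) hL hδ₀ le_rfl hcv₀ hcd₀ hcK2 hcK1 hs hδA J
    obtain ⟨-, e2, e3, e4⟩ := seqB_succ (P := P) (N := N) (C := C) (k := k) (nF := nF) (a := a) (cK2 := cK2) (cK1 := cK1) (s := s)
      (δA := δA) (δ₀ := δ₀) (cv₀ := cv₀) (cd₀ := cd₀) J
    have hJ : (2 : ℝ) ≤ 2 + (J : ℝ) := by have := (Nat.cast_nonneg J : (0 : ℝ) ≤ J); linarith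
    have hrate := seqBU_rate (P := P) (N := N) (C := C) (k := k) (nF := nF) (a := a) (cK2 := cK2) (cK1 := cK1) (s := s) (δA := δA)
      (δ₀ := δ₀) (cv₀ := cv₀) (cd₀ := cd₀) Ĉ2 Ĉ1 (|C.e| * s) τ ((|C.e| * s) ^ 2) (kapU P.d a (|C.e| * s)) (kapFU P.d (|C.e| * s) τ) v₀ w₀ J
    refine ⟨?_, ?_, ?_⟩
    · show ν * cvB P N C k nF a cK2 cK1 s δA δ₀ cv₀ cd₀ (J + 1) ≤ stepBoxVCU P.d (P.L : ℝ) N nF _ 2 (2 + (J : ℝ)) Ĉ2 _ _ _ Ĉ1 _ _ _ _ _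
      rw [e2, hrate]
      exact stepBoxVC_currency hL hmesh hr0 (by norm_num) hJ hν hcK2 hĈ2 hcvJ ihv hcdJ ihd hcSJ ihS hcK1 hĈ1 hσ hκ₂ hτ' (sq_nonneg _) hκ₄
        hK₄ hκF hKF
    · show ν * cdB P N C k nF a cK2 cK1 s δA δ₀ cv₀ cd₀ (J + 1) ≤ stepBoxCU P.d (P.L : ℝ) N nF _ 1 (2 + (J : ℝ)) Ĉ1 _ _ _ Ĉ1 _ _ _ _
      rw [e3, hrate]
      exact stepBoxC_currency hL hmesh hr0 (by norm_num) hJ hν hcK1 hĈ1 hcvJ ihv hcdJ ihd hcSJ ihS hcK1 hĈ1 hσ hκ₂ hτ' (sq_nonneg _) hκ₄ hK₄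
    · show ν * P.mesh 0 * cSB P N C k nF a cK2 cK1 s δA δ₀ cv₀ cd₀ (J + 1) ≤
        kapFU P.d (|C.e| * s) τ * (seqBU P.d (P.L : ℝ) N nF Ĉ2 Ĉ1 (|C.e| * s) τ ((|C.e| * s) ^ 2) (kapU P.d a (|C.e| * s))
          (kapFU P.d (|C.e| * s) τ) δ₀ v₀ w₀ J).2.1
      rw [e4, show ν * P.mesh 0 * (kapF P C s δA * cvB P N C k nF a cK2 cK1 s δA δ₀ cv₀ cd₀ J)
        = (P.mesh 0 * kapF P C s δA) * (ν * cvB P N C k nF a cK2 cK1 s δA δ₀ cv₀ cd₀ J) by ring]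
      exact mul_le_mul hKF ihv (mul_nonneg hν hcvJ) ((mul_nonneg hε hκF).trans hKF)

end Recursion

/-! ## §4 The end sheets in uniform currency -/

section Sheets

/-- the uniform twin of the end-sheet constant `sheetEndC`: `Ĉ₁·S·(8d/δ)^{d−1}·(r/(1−r) + L^{s−1}/(L^{s−1}−1))`, `r = e^{−δθ(L−1)/(2d)}`.
[cite: Balaban1983Higgs3, (1.16) p.414, (2.6) p.424, p.433] -/
def sheetEndCU (d : ℕ) (L : ℝ) (δ θ s Ĉ₁ S : ℝ) : ℝ :=
  Ĉ₁ * S * (faceC₀ d δ *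
    (Real.exp (-(δ * θ * (L - 1) / (2 * d))) / (1 - Real.exp (-(δ * θ * (L - 1) / (2 * d)))) + L ^ (s - 1) / (L ^ (s - 1) - 1)))

/-- the uniform twin of the Hölder end-sheet constant `sheetHolC`: `Ĉ_H·v·(8d/δ)^{d−1}·(θ^{−α}(1+4d/δ)r₁/(1−r₁) + L^{s−1}/(L^{s−1}−1))`,
`r₁ = e^{−(δ/2)θ(L−1)/(2d)}`. [cite: Balaban1983Higgs3, (1.16) p.414, (2.11) p.426, p.433] -/
def sheetHolCU (d : ℕ) (L : ℝ) (δ θ α s CH v : ℝ) : ℝ :=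
  CH * v * (faceC₀ d δ *
    (θ ^ ((1 - α) - 1) * ((1 + 4 * d / δ) *
        (Real.exp (-(δ / 2 * θ * (L - 1) / (2 * d))) / (1 - Real.exp (-(δ / 2 * θ * (L - 1) / (2 * d))))))
      + L ^ (s - 1) / (L ^ (s - 1) - 1)))

/-- the geometric tail `r/(1−r) ≥ 0` of a positive exponent. (folklore analysis) [cite: Balaban1983Higgs3, (2.6) p.424] -/
private theorem tail_nonneg {x : ℝ} (hx : 0 < x) : 0 ≤ Real.exp (-x) / (1 - Real.exp (-x)) := by
  have h1 : Real.exp (-x) < 1 := Real.exp_lt_one_iff.mpr (by linarith)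
  exact div_nonneg (Real.exp_nonneg _) (by linarith)

variable {δ θ s α cS cH cv Ĉ₁ S CH v : ℝ}

/-- **the end sheet in uniform currency**: `(ε^d)^{−1}·sheetEndC(δ, θ, s, c_{K1}, c_S) ≤ sheetEndCU(d, L, δ, θ, s, Ĉ₁, S)` as soon as
`(ε^d)^{−1}c_{K1} ≤ Ĉ₁` and `(ε^d)^{−1}ε·c_S ≤ S` (`δ, θ > 0`, `L > 1`, `s ≥ 1`) — `c_{K1}·c_S·(ε^{d−1})^{−1} = ((ε^d)^{−1}c_{K1})((ε^d)^{−1}ε c_S)·ε^d`.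
[cite: Balaban1983Higgs3, (1.16) p.414, (2.6) p.424, p.433] -/
theorem sheetEndC_currency (hL : 1 < P.L) (hδ : 0 < δ) (hθ : 0 < θ) (hs : 1 ≤ s) {cK1 : ℝ} (hcK1 : 0 ≤ cK1)
    (hĈ₁ : (P.mesh 0 ^ P.d)⁻¹ * cK1 ≤ Ĉ₁) (hcS : 0 ≤ cS) (hS : (P.mesh 0 ^ P.d)⁻¹ * P.mesh 0 * cS ≤ S) :
    (P.mesh 0 ^ P.d)⁻¹ * sheetEndC P δ θ s cK1 cS ≤ sheetEndCU P.d (P.L : ℝ) δ θ s Ĉ₁ S := by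
  have hL1 : (1 : ℝ) < (P.L : ℝ) := by exact_mod_cast hL
  have hd0 : (0 : ℝ) < (P.d : ℝ) := by exact_mod_cast P.hd
  have hE : 0 ≤ (P.mesh 0 ^ P.d)⁻¹ := inv_nonneg.mpr (pow_nonneg (P.mesh_pos 0).le _)
  have hε : 0 ≤ P.mesh 0 := (P.mesh_pos 0).le
  have hx : 0 < δ * θ * ((P.L : ℝ) - 1) / (2 * (P.d : ℝ)) := div_pos (mul_pos (mul_pos hδ hθ) (by linarith)) (by positivity)
  have hR : 0 ≤ faceC₀ P.d δ * (Real.exp (-(δ * θ * ((P.L : ℝ) - 1) / (2 * (P.d : ℝ)))) /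
      (1 - Real.exp (-(δ * θ * ((P.L : ℝ) - 1) / (2 * (P.d : ℝ))))) + (P.L : ℝ) ^ (s - 1) / ((P.L : ℝ) ^ (s - 1) - 1)) :=
    mul_nonneg (faceC₀_nonneg P.d hδ) (add_nonneg (tail_nonneg hx) (gE₀_nonneg hL1.le (by linarith : 0 ≤ s - 1)))
  have hX1 : 0 ≤ (P.mesh 0 ^ P.d)⁻¹ * cK1 := mul_nonneg hE hcK1
  have hXS : 0 ≤ (P.mesh 0 ^ P.d)⁻¹ * P.mesh 0 * cS := mul_nonneg (mul_nonneg hE hε) hcS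
  have hid : (P.mesh 0 ^ P.d)⁻¹ * sheetEndC P δ θ s cK1 cS =
      1 * (((P.mesh 0 ^ P.d)⁻¹ * cK1) * ((P.mesh 0 ^ P.d)⁻¹ * P.mesh 0 * cS)) *
        (faceC₀ P.d δ * (Real.exp (-(δ * θ * ((P.L : ℝ) - 1) / (2 * (P.d : ℝ)))) /
          (1 - Real.exp (-(δ * θ * ((P.L : ℝ) - 1) / (2 * (P.d : ℝ))))) + (P.L : ℝ) ^ (s - 1) / ((P.L : ℝ) ^ (s - 1) - 1))) := by
    have hE0 : P.mesh 0 ^ P.d ≠ 0 := (pow_pos (P.mesh_pos 0) _).ne'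
    unfold sheetEndC faceC₀
    rw [inv_pow_pred_eq]
    field_simp
  have hU : sheetEndCU P.d (P.L : ℝ) δ θ s Ĉ₁ S = 1 * (Ĉ₁ * S) *
        (faceC₀ P.d δ * (Real.exp (-(δ * θ * ((P.L : ℝ) - 1) / (2 * (P.d : ℝ)))) /
          (1 - Real.exp (-(δ * θ * ((P.L : ℝ) - 1) / (2 * (P.d : ℝ))))) + (P.L : ℝ) ^ (s - 1) / ((P.L : ℝ) ^ (s - 1) - 1))) := by
    unfold sheetEndCU; ring
  rw [hid, hU]
  exact prod3_le zero_le_one hX1 hXS hR le_rfl hĈ₁ hS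

/-- **the Hölder end sheet in uniform currency**: `(ε^d)^{−1}·κ_F·sheetHolC(δ, θ, α, s, c_H, c_v) ≤ K_F·sheetHolCU(d, L, δ, θ, α, s, Ĉ_H, v)` as soon
as `ε·κ_F ≤ K_F`, `(ε^d)^{−1}c_H ≤ Ĉ_H`, `(ε^d)^{−1}c_v ≤ v` (`δ, θ > 0`, `L > 1`, `s ≥ 1`). [cite: Balaban1983Higgs3, (1.16) p.414, (2.11) p.426, p.433] -/
theorem sheetHolC_currency (hL : 1 < P.L) (hδ : 0 < δ) (hθ : 0 < θ) (hs : 1 ≤ s) {κF KF : ℝ} (hκF : 0 ≤ κF) (hKF : P.mesh 0 * κF ≤ KF)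
    (hcH : 0 ≤ cH) (hĈH : (P.mesh 0 ^ P.d)⁻¹ * cH ≤ CH) (hcv : 0 ≤ cv) (hv : (P.mesh 0 ^ P.d)⁻¹ * cv ≤ v) :
    (P.mesh 0 ^ P.d)⁻¹ * (κF * sheetHolC P δ θ α s cH cv) ≤ KF * sheetHolCU P.d (P.L : ℝ) δ θ α s CH v := by
  have hL1 : (1 : ℝ) < (P.L : ℝ) := by exact_mod_cast hL
  have hd0 : (0 : ℝ) < (P.d : ℝ) := by exact_mod_cast P.hd
  have hE : 0 ≤ (P.mesh 0 ^ P.d)⁻¹ := inv_nonneg.mpr (pow_nonneg (P.mesh_pos 0).le _)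
  have hε : 0 ≤ P.mesh 0 := (P.mesh_pos 0).le
  have hx : 0 < δ / 2 * θ * ((P.L : ℝ) - 1) / (2 * (P.d : ℝ)) := div_pos (mul_pos (mul_pos (half_pos hδ) hθ) (by linarith)) (by positivity)
  have hR : 0 ≤ faceC₀ P.d δ * (θ ^ ((1 - α) - 1) * ((1 + 4 * (P.d : ℝ) / δ) *
        (Real.exp (-(δ / 2 * θ * ((P.L : ℝ) - 1) / (2 * (P.d : ℝ)))) / (1 - Real.exp (-(δ / 2 * θ * ((P.L : ℝ) - 1) / (2 * (P.d : ℝ)))))))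
      + (P.L : ℝ) ^ (s - 1) / ((P.L : ℝ) ^ (s - 1) - 1)) :=
    mul_nonneg (faceC₀_nonneg P.d hδ) (add_nonneg (mul_nonneg (Real.rpow_nonneg hθ.le _) (mul_nonneg (by positivity) (tail_nonneg hx)))
      (gE₀_nonneg hL1.le (by linarith : 0 ≤ s - 1)))
  have hXF : 0 ≤ P.mesh 0 * κF := mul_nonneg hε hκF
  have hXH : 0 ≤ (P.mesh 0 ^ P.d)⁻¹ * cH := mul_nonneg hE hcH
  have hXv : 0 ≤ (P.mesh 0 ^ P.d)⁻¹ * cv := mul_nonneg hE hcv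
  have hid : (P.mesh 0 ^ P.d)⁻¹ * (κF * sheetHolC P δ θ α s cH cv) =
      (P.mesh 0 * κF) * (((P.mesh 0 ^ P.d)⁻¹ * cH) * ((P.mesh 0 ^ P.d)⁻¹ * cv)) *
        (faceC₀ P.d δ * (θ ^ ((1 - α) - 1) * ((1 + 4 * (P.d : ℝ) / δ) *
          (Real.exp (-(δ / 2 * θ * ((P.L : ℝ) - 1) / (2 * (P.d : ℝ)))) / (1 - Real.exp (-(δ / 2 * θ * ((P.L : ℝ) - 1) / (2 * (P.d : ℝ)))))))
        + (P.L : ℝ) ^ (s - 1) / ((P.L : ℝ) ^ (s - 1) - 1))) := by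
    have hE0 : P.mesh 0 ^ P.d ≠ 0 := (pow_pos (P.mesh_pos 0) _).ne'
    unfold sheetHolC faceC₀
    rw [inv_pow_pred_eq]
    field_simp
  have hU : KF * sheetHolCU P.d (P.L : ℝ) δ θ α s CH v = KF * (CH * v) *
        (faceC₀ P.d δ * (θ ^ ((1 - α) - 1) * ((1 + 4 * (P.d : ℝ) / δ) *
          (Real.exp (-(δ / 2 * θ * ((P.L : ℝ) - 1) / (2 * (P.d : ℝ)))) / (1 - Real.exp (-(δ / 2 * θ * ((P.L : ℝ) - 1) / (2 * (P.d : ℝ)))))))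
        + (P.L : ℝ) ^ (s - 1) / ((P.L : ℝ) ^ (s - 1) - 1))) := by
    unfold sheetHolCU; ring
  rw [hid, hU]
  exact prod3_le hXF hXH hXv hR hKF hĈH hv

end Sheets

/-! ## §5 The displayed constants of route γ′ are uniform in `ε` and `k` -/

section Kernel

/-- the uniform box recursion at the unit seeds `(δ₁; C, C(1+eσ))` of the cell-box plugs. [cite: Balaban1983Higgs3, (1.16) p.414, (2.10) p.426] -/
def seqBU₁ (d : ℕ) (L : ℝ) (N nF : ℕ) (Cst δ₁ a σ τ : ℝ) : ℕ → ℝ × ℝ × ℝ × ℝ :=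
  seqBU d L N nF Cst (Cst * (1 + Real.exp 1 * σ)) σ τ (σ ^ 2) (kapU d a σ) (kapFU d σ τ) δ₁ Cst (Cst * (1 + Real.exp 1 * σ))

/-- **the uniform value constant on a box** `valCBU(d, L, N, n_F, C, δ₁, a, σ, τ; M) = #Ix·(seqBU₁ … M).2.1/(L^{2+M−d} − 1)` — NO `ε`, NO `k`.
[cite: Balaban1983Higgs3, (1.16) p.414, Prop. 1 pp.420–421, p.433] -/
def valCBU (d : ℕ) (L : ℝ) (N nF : ℕ) (Cst δ₁ a σ τ : ℝ) (M : ℕ) : ℝ :=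
  (Fintype.card (Ix N) : ℝ) * ((seqBU₁ d L N nF Cst δ₁ a σ τ M).2.1 / (L ^ ((2 : ℝ) + (M : ℝ) - (d : ℝ)) - 1))

/-- **the uniform regular-derivative constant on a box** `derCBU(…; M) = #Ix·(seqBU₁ … M).2.2.1/(L^{1+M−d} − 1)`.
[cite: Balaban1983Higgs3, (1.16) p.414, Prop. 1 pp.420–421, p.433] -/
def derCBU (d : ℕ) (L : ℝ) (N nF : ℕ) (Cst δ₁ a σ τ : ℝ) (M : ℕ) : ℝ :=
  (Fintype.card (Ix N) : ℝ) * ((seqBU₁ d L N nF Cst δ₁ a σ τ M).2.2.1 / (L ^ ((1 : ℝ) + (M : ℝ) - (d : ℝ)) - 1))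

/-- **the uniform derivative constant with the margin** `derCBθU(…, θ; M) = derCBU(M) + #Ix·n_F·sheetEndCU(δ_M, θ, 1+M, C(1+eσ), S_M)/(L^{1+M−d} − 1)`.
[cite: Balaban1983Higgs3, (1.16) p.414, Prop. 1 pp.420–421, p.433] -/
def derCBθU (d : ℕ) (L : ℝ) (N nF : ℕ) (Cst δ₁ a σ τ θ : ℝ) (M : ℕ) : ℝ :=
  derCBU d L N nF Cst δ₁ a σ τ M
    + (Fintype.card (Ix N) : ℝ) * ((nF : ℝ) *
        (sheetEndCU d L (seqBU₁ d L N nF Cst δ₁ a σ τ M).1 θ (1 + (M : ℝ)) (Cst * (1 + Real.exp 1 * σ)) (seqBU₁ d L N nF Cst δ₁ a σ τ M).2.2.2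
          / (L ^ ((1 : ℝ) + (M : ℝ) - (d : ℝ)) - 1)))

/-- **the uniform Hölder constant with the margin** `holCBθU(…, C_H, α, θ; J) = 2·#Ix·(stepBoxCU(δ_J, 1−α, 2+J, C_H, state J) +
kapFU·n_F·sheetHolCU(δ_J, θ, α, 2+J, C_H, v_J))/(L^{1+(J+1)−α−d} − 1)`. [cite: Balaban1983Higgs3, (1.16) p.414, Prop. 1 pp.420–421, (2.11) p.426, p.433] -/
def holCBθU (d : ℕ) (L : ℝ) (N nF : ℕ) (Cst CH δ₁ a α σ τ θ : ℝ) (J : ℕ) : ℝ :=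
  2 * ((Fintype.card (Ix N) : ℝ) *
    ((stepBoxCU d L N nF (seqBU₁ d L N nF Cst δ₁ a σ τ J).1 (1 - α) (2 + (J : ℝ)) CH (seqBU₁ d L N nF Cst δ₁ a σ τ J).2.1
          (seqBU₁ d L N nF Cst δ₁ a σ τ J).2.2.1 (seqBU₁ d L N nF Cst δ₁ a σ τ J).2.2.2 (Cst * (1 + Real.exp 1 * σ)) σ τ (σ ^ 2) (kapU d a σ)
        + kapFU d σ τ * (nF : ℝ) *
          sheetHolCU d L (seqBU₁ d L N nF Cst δ₁ a σ τ J).1 θ α (2 + (J : ℝ)) CH (seqBU₁ d L N nF Cst δ₁ a σ τ J).2.1)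
      / (L ^ ((1 : ℝ) + ((J + 1 : ℕ) : ℝ) - α - (d : ℝ)) - 1)))

variable {C : ChargeData N} {k nF : ℕ} {a δ₁ Cst s δA τ θ : ℝ}

/-- the hypotheses of `seqB_currency` at the unit seeds `(ε^dC, cK1)` with `ν = (ε^d)^{−1}` (shared by the four theorems below).
[cite: Balaban1983Higgs3, (1.16) p.414, (2.10) p.426] -/
theorem seqB_currency₁ (hL : 1 < P.L) (hk : 1 ≤ k) (hmesh : P.mesh k ≤ 1) (ha : 0 < a) (hδ₁ : 0 < δ₁) (hCst : 0 ≤ Cst) (hs : 0 ≤ s)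
    (hδA : 0 ≤ δA) (hτ : (P.L : ℝ) ^ k * (|C.e| * δA) ≤ τ) (J : ℕ) :
    (P.mesh 0 ^ P.d)⁻¹ * cvB P N C k nF a (P.mesh 0 ^ P.d * Cst) (cK1 P C k Cst s) s δA δ₁ (P.mesh 0 ^ P.d * Cst) (cK1 P C k Cst s) J ≤
        (seqBU₁ P.d (P.L : ℝ) N nF Cst δ₁ a (|C.e| * s) τ J).2.1 ∧
      (P.mesh 0 ^ P.d)⁻¹ * cdB P N C k nF a (P.mesh 0 ^ P.d * Cst) (cK1 P C k Cst s) s δA δ₁ (P.mesh 0 ^ P.d * Cst) (cK1 P C k Cst s) J ≤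
        (seqBU₁ P.d (P.L : ℝ) N nF Cst δ₁ a (|C.e| * s) τ J).2.2.1 ∧
      (P.mesh 0 ^ P.d)⁻¹ * P.mesh 0 *
          cSB P N C k nF a (P.mesh 0 ^ P.d * Cst) (cK1 P C k Cst s) s δA δ₁ (P.mesh 0 ^ P.d * Cst) (cK1 P C k Cst s) J ≤
        (seqBU₁ P.d (P.L : ℝ) N nF Cst δ₁ a (|C.e| * s) τ J).2.2.2 := by
  have hE : 0 ≤ (P.mesh 0 ^ P.d)⁻¹ := inv_nonneg.mpr (pow_nonneg (P.mesh_pos 0).le _)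
  have hc2 : 0 ≤ P.mesh 0 ^ P.d * Cst := mul_nonneg (pow_nonneg (P.mesh_pos 0).le _) hCst
  obtain ⟨-, hc1⟩ := cK1_ge (P := P) (C := C) (k := k) hCst hs
  exact seqB_currency hL hk hmesh ha hs hδA hc2 (inv_mul_cK2_eq (P := P) Cst).le hc1 (inv_mul_cK1_le hmesh hCst hs) hδ₁ hc2 hc1 hE
    (inv_mul_cK2_eq (P := P) Cst).le (inv_mul_cK1_le hmesh hCst hs) hτ J

/-- **THE VALUE CONSTANT OF (1.16) ON A BOX IS UNIFORM IN `ε` AND `k`**: for `L > 1`, `1 ≤ k`, `L^kε ≤ 1`, `a > 0`, `δ₁ > 0`, `C, s, δ_A ≥ 0`,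
`L^k|e|δ_A ≤ τ`, `d < M + 2`: `valCB(k, n_F, a, ε^dC, cK1, s, δ_A, δ₁; M) ≤ valCBU(d, L, N, n_F, C, δ₁, a, |e|s, τ; M)` — the constant `C_V` of the
binder `hV` on `□` (`kernel116_value_cellBox_le`) may be taken independent of the lattice spacing and of the scale.
[cite: Balaban1983Higgs3, (1.16) p.414, Prop. 1 pp.420–421, (2.5) p.424, p.433] -/
theorem valCB_currency (hL : 1 < P.L) (hk : 1 ≤ k) (hmesh : P.mesh k ≤ 1) (ha : 0 < a) (hδ₁ : 0 < δ₁) (hCst : 0 ≤ Cst) (hs : 0 ≤ s)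
    (hδA : 0 ≤ δA) (hτ : (P.L : ℝ) ^ k * (|C.e| * δA) ≤ τ) (M : ℕ) (hd : (P.d : ℝ) < (M : ℝ) + 2) :
    valCB P N C k nF a (P.mesh 0 ^ P.d * Cst) (cK1 P C k Cst s) s δA δ₁ M ≤ valCBU P.d (P.L : ℝ) N nF Cst δ₁ a (|C.e| * s) τ M := by
  have hL1 : (1 : ℝ) < (P.L : ℝ) := by exact_mod_cast hL
  have hD : 0 < (P.L : ℝ) ^ ((2 : ℝ) + (M : ℝ) - (P.d : ℝ)) - 1 := by
    have := Real.one_lt_rpow hL1 (show (0 : ℝ) < 2 + (M : ℝ) - (P.d : ℝ) by linarith); linarith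
  have h := (seqB_currency₁ (nF := nF) hL hk hmesh ha hδ₁ hCst hs hδA hτ M).1
  unfold valCB valCBU
  rw [show ∀ X : ℝ, (P.mesh 0 ^ P.d)⁻¹ * (Fintype.card (Ix N) : ℝ) * (X / ((P.L : ℝ) ^ ((2 : ℝ) + (M : ℝ) - (P.d : ℝ)) - 1))
      = (Fintype.card (Ix N) : ℝ) * (((P.mesh 0 ^ P.d)⁻¹ * X) / ((P.L : ℝ) ^ ((2 : ℝ) + (M : ℝ) - (P.d : ℝ)) - 1)) from fun X => by ring]
  exact mul_le_mul_of_nonneg_left (div_le_div_of_nonneg_right h hD.le) (Nat.cast_nonneg _)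

/-- **THE REGULAR-DERIVATIVE CONSTANT OF (1.16) ON A BOX IS UNIFORM IN `ε` AND `k`** (`d < M + 1`): `derCB(…; M) ≤ derCBU(d, L, N, n_F, C, δ₁, a, |e|s, τ; M)`.
[cite: Balaban1983Higgs3, (1.16) p.414, Prop. 1 pp.420–421, (2.5) p.424, p.433] -/
theorem derCB_currency (hL : 1 < P.L) (hk : 1 ≤ k) (hmesh : P.mesh k ≤ 1) (ha : 0 < a) (hδ₁ : 0 < δ₁) (hCst : 0 ≤ Cst) (hs : 0 ≤ s)
    (hδA : 0 ≤ δA) (hτ : (P.L : ℝ) ^ k * (|C.e| * δA) ≤ τ) (M : ℕ) (hd : (P.d : ℝ) < (M : ℝ) + 1) :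
    derCB P N C k nF a (P.mesh 0 ^ P.d * Cst) (cK1 P C k Cst s) s δA δ₁ M ≤ derCBU P.d (P.L : ℝ) N nF Cst δ₁ a (|C.e| * s) τ M := by
  have hL1 : (1 : ℝ) < (P.L : ℝ) := by exact_mod_cast hL
  have hD : 0 < (P.L : ℝ) ^ ((1 : ℝ) + (M : ℝ) - (P.d : ℝ)) - 1 := by
    have := Real.one_lt_rpow hL1 (show (0 : ℝ) < 1 + (M : ℝ) - (P.d : ℝ) by linarith); linarith
  have h := (seqB_currency₁ (nF := nF) hL hk hmesh ha hδ₁ hCst hs hδA hτ M).2.1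
  unfold derCB derCBU
  rw [show ∀ X : ℝ, (P.mesh 0 ^ P.d)⁻¹ * (Fintype.card (Ix N) : ℝ) * (X / ((P.L : ℝ) ^ ((1 : ℝ) + (M : ℝ) - (P.d : ℝ)) - 1))
      = (Fintype.card (Ix N) : ℝ) * (((P.mesh 0 ^ P.d)⁻¹ * X) / ((P.L : ℝ) ^ ((1 : ℝ) + (M : ℝ) - (P.d : ℝ)) - 1)) from fun X => by ring]
  exact mul_le_mul_of_nonneg_left (div_le_div_of_nonneg_right h hD.le) (Nat.cast_nonneg _)

/-- **THE DERIVATIVE CONSTANT WITH THE END-SHEET MARGIN IS UNIFORM IN `ε` AND `k`** (`θ > 0`, `d < M + 1`):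
`derCBθ(…, θ; M) ≤ derCBθU(d, L, N, n_F, C, δ₁, a, |e|s, τ, θ; M)` — the constant `C_D` of the binder `hDv` on `□`
(`kernel116_deriv_cellBox_interior_le`, `θ = 1`). [cite: Balaban1983Higgs3, (1.16) p.414, Prop. 1 pp.420–421, (2.5) p.424, p.433] -/
theorem derCBθ_currency (hL : 1 < P.L) (hk : 1 ≤ k) (hmesh : P.mesh k ≤ 1) (ha : 0 < a) (hδ₁ : 0 < δ₁) (hCst : 0 ≤ Cst) (hs : 0 ≤ s)
    (hδA : 0 ≤ δA) (hτ : (P.L : ℝ) ^ k * (|C.e| * δA) ≤ τ) (hθ : 0 < θ) (M : ℕ) (hd : (P.d : ℝ) < (M : ℝ) + 1) :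
    derCBθ P N C k nF a (P.mesh 0 ^ P.d * Cst) (cK1 P C k Cst s) s δA δ₁ θ M ≤ derCBθU P.d (P.L : ℝ) N nF Cst δ₁ a (|C.e| * s) τ θ M := by
  have hL1 : (1 : ℝ) < (P.L : ℝ) := by exact_mod_cast hL
  have hD : 0 < (P.L : ℝ) ^ ((1 : ℝ) + (M : ℝ) - (P.d : ℝ)) - 1 := by
    have := Real.one_lt_rpow hL1 (show (0 : ℝ) < 1 + (M : ℝ) - (P.d : ℝ) by linarith); linarith
  have hder := derCB_currency (nF := nF) hL hk hmesh ha hδ₁ hCst hs hδA hτ M hd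
  obtain ⟨-, -, hS⟩ := seqB_currency₁ (nF := nF) hL hk hmesh ha hδ₁ hCst hs hδA hτ M
  have hc2 : 0 ≤ P.mesh 0 ^ P.d * Cst := mul_nonneg (pow_nonneg (P.mesh_pos 0).le _) hCst
  obtain ⟨-, hc1⟩ := cK1_ge (P := P) (C := C) (k := k) hCst hs
  obtain ⟨hr0, -, -, -, hcS⟩ := seqB_pos (P := P) (N := N) (C := C) (k := k) (nF := nF) (a := a) (cK2 := P.mesh 0 ^ P.d * Cst)
    (cK1 := cK1 P C k Cst s) (s := s) (δA := δA) (δ₀ := δ₁) (cv₀ := P.mesh 0 ^ P.d * Cst) (cd₀ := cK1 P C k Cst s) (δ₁ := δ₁) hL hδ₁ le_rfl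
    hc2 hc1 hc2 hc1 hs hδA M
  have hsheet := sheetEndC_currency (θ := θ) (s := 1 + (M : ℝ)) hL hr0 hθ (by have := (Nat.cast_nonneg M : (0 : ℝ) ≤ M); linarith) hc1
    (inv_mul_cK1_le hmesh hCst hs) hcS hS
  unfold derCBθ derCBθU seqBU₁
  rw [seqBU_rate (P := P) (N := N) (C := C) (k := k) (nF := nF) (a := a) (cK2 := P.mesh 0 ^ P.d * Cst) (cK1 := cK1 P C k Cst s) (s := s)
    (δA := δA) (δ₀ := δ₁) (cv₀ := P.mesh 0 ^ P.d * Cst) (cd₀ := cK1 P C k Cst s)]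
  refine add_le_add hder ?_
  rw [show ∀ X : ℝ, (P.mesh 0 ^ P.d)⁻¹ * (Fintype.card (Ix N) : ℝ) * ((nF : ℝ) * (X / ((P.L : ℝ) ^ ((1 : ℝ) + (M : ℝ) - (P.d : ℝ)) - 1)))
      = (Fintype.card (Ix N) : ℝ) * ((nF : ℝ) * (((P.mesh 0 ^ P.d)⁻¹ * X) / ((P.L : ℝ) ^ ((1 : ℝ) + (M : ℝ) - (P.d : ℝ)) - 1))) from fun X => by ring]
  exact mul_le_mul_of_nonneg_left (mul_le_mul_of_nonneg_left (div_le_div_of_nonneg_right hsheet hD.le) (Nat.cast_nonneg _)) (Nat.cast_nonneg _)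

/-- **THE HÖLDER CONSTANT WITH THE MARGIN IS UNIFORM IN `ε` AND `k`**: with the (2.11) Hölder column constant of the form `ε^dC_H`, `C_H ≥ 0`, `α < 1`,
`θ > 0` and `d < 1 + (J+1) − α`: `holCBθ(…, α, ε^dC_H, θ; J) ≤ holCBθU(d, L, N, n_F, C, C_H, δ₁, a, α, |e|s, τ, θ; J)` — the constant `C_H` of the binder
`hH` on `□` (`kernel116_holder_cellBox_interior_le`). [cite: Balaban1983Higgs3, (1.16) p.414, Prop. 1 pp.420–421, (2.5) p.424, (2.11) p.426, p.433] -/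
theorem holCBθ_currency (hL : 1 < P.L) (hk : 1 ≤ k) (hmesh : P.mesh k ≤ 1) (ha : 0 < a) (hδ₁ : 0 < δ₁) (hCst : 0 ≤ Cst) (hs : 0 ≤ s)
    (hδA : 0 ≤ δA) (hτ : (P.L : ℝ) ^ k * (|C.e| * δA) ≤ τ) {α CH : ℝ} (hα1 : α < 1) (hCH : 0 ≤ CH) (hθ : 0 < θ) (J : ℕ)
    (hd : (P.d : ℝ) < 1 + ((J + 1 : ℕ) : ℝ) - α) :
    holCBθ P N C k nF a (P.mesh 0 ^ P.d * Cst) (cK1 P C k Cst s) s δA δ₁ α (P.mesh 0 ^ P.d * CH) θ J ≤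
      holCBθU P.d (P.L : ℝ) N nF Cst CH δ₁ a α (|C.e| * s) τ θ J := by
  have hL1 : (1 : ℝ) < (P.L : ℝ) := by exact_mod_cast hL
  have hE : 0 ≤ (P.mesh 0 ^ P.d)⁻¹ := inv_nonneg.mpr (pow_nonneg (P.mesh_pos 0).le _)
  have hc2 : 0 ≤ P.mesh 0 ^ P.d * Cst := mul_nonneg (pow_nonneg (P.mesh_pos 0).le _) hCst
  have hcH : 0 ≤ P.mesh 0 ^ P.d * CH := mul_nonneg (pow_nonneg (P.mesh_pos 0).le _) hCH
  obtain ⟨-, hc1⟩ := cK1_ge (P := P) (C := C) (k := k) hCst hs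
  have hσ : 0 ≤ |C.e| * s := mul_nonneg (abs_nonneg _) hs
  have hκ₂ : 0 ≤ (P.mesh 0)⁻¹ * (|C.e| * δA) := mul_nonneg (inv_nonneg.mpr (P.mesh_pos 0).le) (mul_nonneg (abs_nonneg _) hδA)
  have hτ' : P.mesh k * ((P.mesh 0)⁻¹ * (|C.e| * δA)) ≤ τ := by rw [mesh_mul_inv_mesh_zero_mul]; exact hτ
  have hκ₄ : 0 ≤ kap4 P C k a s := kap4_nonneg hs
  have hK₄ : P.mesh k * kap4 P C k a s ≤ kapU P.d a (|C.e| * s) := mesh_mul_kap4_le hL hk hmesh ha hs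
  have hκF : 0 ≤ kapF P C s δA := kapF_nonneg hs hδA
  have hKF : P.mesh 0 * kapF P C s δA ≤ kapFU P.d (|C.e| * s) τ := mesh_zero_mul_kapF_le hmesh hs hδA hτ
  have hD : 0 < (P.L : ℝ) ^ ((1 : ℝ) + ((J + 1 : ℕ) : ℝ) - α - (P.d : ℝ)) - 1 := by
    have := Real.one_lt_rpow hL1 (show (0 : ℝ) < 1 + ((J + 1 : ℕ) : ℝ) - α - (P.d : ℝ) by linarith); linarith
  obtain ⟨hv, hw, hS⟩ := seqB_currency₁ (nF := nF) hL hk hmesh ha hδ₁ hCst hs hδA hτ J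
  obtain ⟨hr0, -, hcvJ, hcdJ, hcSJ⟩ := seqB_pos (P := P) (N := N) (C := C) (k := k) (nF := nF) (a := a) (cK2 := P.mesh 0 ^ P.d * Cst)
    (cK1 := cK1 P C k Cst s) (s := s) (δA := δA) (δ₀ := δ₁) (cv₀ := P.mesh 0 ^ P.d * Cst) (cd₀ := cK1 P C k Cst s) (δ₁ := δ₁) hL hδ₁ le_rfl
    hc2 hc1 hc2 hc1 hs hδA J
  have hJ : (2 : ℝ) ≤ 2 + (J : ℝ) := by have := (Nat.cast_nonneg J : (0 : ℝ) ≤ J); linarith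
  have hstep := stepBoxC_currency (N := N) (nF := nF) (aK := 1 - α) hL hmesh hr0 (by linarith) hJ hE hcH (inv_mul_cK2_eq (P := P) CH).le hcvJ hv
    hcdJ hw hcSJ hS hc1 (inv_mul_cK1_le hmesh hCst hs) hσ hκ₂ hτ' (sq_nonneg (|C.e| * s)) hκ₄ hK₄
  have hsheet := sheetHolC_currency (α := α) (s := 2 + (J : ℝ)) hL hr0 hθ (by linarith) hκF hKF hcH (inv_mul_cK2_eq (P := P) CH).le hcvJ hv
  have hsum := add_le_add hstep (mul_le_mul_of_nonneg_left hsheet (Nat.cast_nonneg nF))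
  unfold holCBθ holCBθU seqBU₁
  rw [seqBU_rate (P := P) (N := N) (C := C) (k := k) (nF := nF) (a := a) (cK2 := P.mesh 0 ^ P.d * Cst) (cK1 := cK1 P C k Cst s) (s := s)
    (δA := δA) (δ₀ := δ₁) (cv₀ := P.mesh 0 ^ P.d * Cst) (cd₀ := cK1 P C k Cst s)]
  rw [show ∀ X Y : ℝ, 2 * ((P.mesh 0 ^ P.d)⁻¹ * (Fintype.card (Ix N) : ℝ) *
      ((X + kapF P C s δA * (nF : ℝ) * Y) / ((P.L : ℝ) ^ ((1 : ℝ) + ((J + 1 : ℕ) : ℝ) - α - (P.d : ℝ)) - 1)))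
      = 2 * ((Fintype.card (Ix N) : ℝ) * (((P.mesh 0 ^ P.d)⁻¹ * X + (nF : ℝ) * ((P.mesh 0 ^ P.d)⁻¹ * (kapF P C s δA * Y)))
          / ((P.L : ℝ) ^ ((1 : ℝ) + ((J + 1 : ℕ) : ℝ) - α - (P.d : ℝ)) - 1))) from fun X Y => by ring,
    show ∀ X Y : ℝ, 2 * ((Fintype.card (Ix N) : ℝ) * ((X + kapFU P.d (|C.e| * s) τ * (nF : ℝ) * Y)
      / ((P.L : ℝ) ^ ((1 : ℝ) + ((J + 1 : ℕ) : ℝ) - α - (P.d : ℝ)) - 1)))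
      = 2 * ((Fintype.card (Ix N) : ℝ) * ((X + (nF : ℝ) * (kapFU P.d (|C.e| * s) τ * Y))
          / ((P.L : ℝ) ^ ((1 : ℝ) + ((J + 1 : ℕ) : ℝ) - α - (P.d : ℝ)) - 1))) from fun X Y => by ring]
  exact mul_le_mul_of_nonneg_left (mul_le_mul_of_nonneg_left (div_le_div_of_nonneg_right hsum hD.le) (Nat.cast_nonneg _)) (by norm_num)

end Kernel

end Literature.MathematicalPhysics.QuantumFieldTheory.Balaban1983to89.B3Op116KernelCurrencyBox
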